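import Literature.NumberTheory.LFunctions.WeilExplicitContinuous
import Literature.NumberTheory.LFunctions.WeilExplicitArchTermProofs
import Summits.RiemannHypothesis.RiemannHypothesis.Theorems.SoloInformedLipschitzBombieri
import Mathlib.Analysis.Normed.Group.Tannery
import Mathlib.Analysis.SpecialFunctions.Gamma.Basic

/-!
# The archimedean series of the explicit formula along a double mollification (column DBR; RH-FREE)

RH-FREE throughout; nothing here bears on the truth of RH.  Infrastructure for the pairing algebra of
`Theorems.SuzukiThetaFlowDefs.FlowPairing` (Weil side, archimedean term): the tree proves, for SMOOTH
compactly supported `g` (`IsWeilTest g`), Bombieri's series form of the archimedean integral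
`Σₙ (4π g(0)/(n+1) − 4π ∫₀^∞ (g(x)+g(−x)) e^{−(2n+½)x} dx) = 2·weilArchIntegral g + 4πγ g(0)`
(`Literature.NumberTheory.LFunctions.hasSum_weilArchIntegral`, [Bo00] (2.5)–(2.7)).  The window outputs of
the θ-flow are NOT smooth; they are continuous, compactly supported and HÖLDER.  This file runs the
`x`-side of the extension:

* §1 one mollification step `f ⋆ φ_k` (`WeilContinuous.moll`; `weilConv_moll_eq_integral` of the tree): sup-norm, Hölder modulus, `‖f ⋆ φ_k − f‖_∞ ≤ C r_k^α`;
* §2 the DOUBLE mollification `ψ_k = (φ ⋆ φ_k) ⋆ φ_k` (test function; transform `φ̂ · φ̂_k²` on the critical line);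
* §3 a uniform summable majorant of the series terms for bounded Hölder `f` (`norm_archSeriesTerm_le`);
* §4 Tannery: `2·weilArchIntegral ψ_k + 4πγ ψ_k(0) → Σₙ Tₙ(φ)` (`tendsto_archSeries_moll2`), `Σₙ Tₙ(φ)` summable.

References: [Bo00] E. Bombieri, Rend. Lincei (9) 11 (2000), §2 (2.5)–(2.8); [Su20] M. Suzuki, ASPM 84 (2020).
-/

noncomputable section

-- D-0017: `Summit.<S>.<S>.…` is the designed namespace of a single-problem summit.
set_option linter.dupNamespace false

open Complex Filter Set MeasureTheory Topology
open scoped Real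

namespace Summit.RiemannHypothesis.RiemannHypothesis.Theorems.SuzukiFlowPairing

open Literature.NumberTheory.LFunctions Literature.NumberTheory.LFunctions.WeilContinuous

/-! ## §1 One mollification step -/

/-- RH-FREE.  The shifted integrand `f(x − v) φ_k(v)` is integrable for continuous `f`. -/
theorem integrable_shift_mul_moll {f : ℝ → ℂ} (hf : Continuous f) (k : ℕ) (x : ℝ) :
    Integrable fun v : ℝ ↦ f (x - v) * moll k v :=
  ((hf.comp (continuous_const.sub continuous_id)).mul (continuous_moll k)).integrable_of_hasCompactSupport
    (hasCompactSupport_moll k).mul_left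

/-- RH-FREE.  **One-step estimate**: if `‖f(x − v) − c‖ ≤ δ` for `|v| < r_k` then `‖(f ⋆ φ_k)(x) − c‖ ≤ δ`
(`φ_k ≥ 0`, `∫ φ_k = 1`, `supp φ_k ⊆ [−r_k, r_k]`). -/
theorem norm_weilConv_moll_sub_const_le {f : ℝ → ℂ} (hf : Continuous f) (k : ℕ) (x : ℝ) (c : ℂ) {δ : ℝ}
    (h : ∀ v : ℝ, |v| < (bump k).rOut → ‖f (x - v) - c‖ ≤ δ) :
    ‖weilConv f (moll k) x - c‖ ≤ δ := by
  have hint' : Integrable fun v : ℝ ↦ c * moll k v :=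
    ((continuous_moll k).integrable_of_hasCompactSupport (hasCompactSupport_moll k)).const_mul c
  have hc : c = ∫ v : ℝ, c * moll k v := by rw [MeasureTheory.integral_const_mul, integral_moll, mul_one]
  rw [weilConv_moll_eq_integral, hc, ← integral_sub (integrable_shift_mul_moll hf k x) hint']
  calc ‖∫ v : ℝ, (f (x - v) * moll k v - c * moll k v)‖
      ≤ ∫ v : ℝ, ‖f (x - v) * moll k v - c * moll k v‖ := norm_integral_le_integral_norm _
    _ ≤ ∫ v : ℝ, δ * ‖moll k v‖ := by
        refine integral_mono_of_nonneg (Eventually.of_forall fun _ ↦ norm_nonneg _)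
          ((integrable_norm_moll k).const_mul δ) (Eventually.of_forall fun v ↦ ?_)
        dsimp only
        rw [← sub_mul, norm_mul]
        rcases le_or_gt (bump k).rOut |v| with hv | hv
        · rw [moll_eq_zero hv]; simp
        · exact mul_le_mul_of_nonneg_right (h v hv) (norm_nonneg _)
    _ = δ := by rw [MeasureTheory.integral_const_mul, integral_norm_moll, mul_one]

/-- RH-FREE.  `‖f ⋆ φ_k‖_∞ ≤ ‖f‖_∞`. -/
theorem norm_weilConv_moll_le {f : ℝ → ℂ} (hf : Continuous f) {M : ℝ} (hM : ∀ x, ‖f x‖ ≤ M) (k : ℕ)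
    (x : ℝ) : ‖weilConv f (moll k) x‖ ≤ M := by
  simpa using norm_weilConv_moll_sub_const_le hf k x 0 (δ := M) (fun v _ ↦ by rw [sub_zero]; exact hM _)

/-- RH-FREE.  **Approximation with a rate**: if `‖f(a+y) − f(a)‖ ≤ C|y|^α` (`|y| ≤ 1`) then
`‖(f ⋆ φ_k)(x) − f(x)‖ ≤ C r_k^α` for every `x` (`r_k = 1/(k+1) ≤ 1`). -/
theorem norm_weilConv_moll_sub_self_le {f : ℝ → ℂ} (hf : Continuous f) {C α : ℝ} (hC : 0 ≤ C) (hα : 0 < α)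
    (hH : ∀ a y : ℝ, |y| ≤ 1 → ‖f (a + y) - f a‖ ≤ C * |y| ^ α) (k : ℕ) (x : ℝ) :
    ‖weilConv f (moll k) x - f x‖ ≤ C * (bump k).rOut ^ α := by
  refine norm_weilConv_moll_sub_const_le hf k x (f x) fun v hv ↦ ?_
  have hv1 : |v| ≤ 1 := hv.le.trans (bump_rOut_le_one k)
  have h := hH x (-v) (by rwa [abs_neg])
  rw [← sub_eq_add_neg, abs_neg] at h
  exact h.trans (mul_le_mul_of_nonneg_left (Real.rpow_le_rpow (abs_nonneg v) hv.le hα.le) hC)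

/-- RH-FREE.  **Hölder modulus is preserved**: `‖(f ⋆ φ_k)(a+y) − (f ⋆ φ_k)(a)‖ ≤ C|y|^α`. -/
theorem holder_weilConv_moll {f : ℝ → ℂ} (hf : Continuous f) {C α : ℝ}
    (hH : ∀ a y : ℝ, |y| ≤ 1 → ‖f (a + y) - f a‖ ≤ C * |y| ^ α) (k : ℕ) (a y : ℝ) (hy : |y| ≤ 1) :
    ‖weilConv f (moll k) (a + y) - weilConv f (moll k) a‖ ≤ C * |y| ^ α := by
  rw [weilConv_moll_eq_integral, weilConv_moll_eq_integral,
    ← integral_sub (integrable_shift_mul_moll hf k _) (integrable_shift_mul_moll hf k _)]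
  calc ‖∫ v, (f (a + y - v) * moll k v - f (a - v) * moll k v)‖
      ≤ ∫ v, ‖f (a + y - v) * moll k v - f (a - v) * moll k v‖ := norm_integral_le_integral_norm _
    _ ≤ ∫ v, (C * |y| ^ α) * ‖moll k v‖ := by
        refine integral_mono_of_nonneg (Eventually.of_forall fun _ ↦ norm_nonneg _)
          ((integrable_norm_moll k).const_mul _) (Eventually.of_forall fun v ↦ ?_)
        dsimp only
        rw [← sub_mul, norm_mul]
        refine mul_le_mul_of_nonneg_right ?_ (norm_nonneg _)
        have h := hH (a - v) y hy
        rwa [show a - v + y = a + y - v by ring] at h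
    _ = C * |y| ^ α := by rw [MeasureTheory.integral_const_mul, integral_norm_moll, mul_one]

/-! ## §2 The double mollification `ψ_k = (φ ⋆ φ_k) ⋆ φ_k` -/

variable {φ : ℝ → ℂ}

/-- RH-FREE.  `ψ_k` is a test function. -/
theorem isWeilTest_moll2 (hφc : Continuous φ) (hφs : HasCompactSupport φ) (k : ℕ) :
    IsWeilTest (weilConv (weilConv φ (moll k)) (moll k)) :=
  isWeilTest_weilConv_moll (isWeilTest_weilConv_moll hφc hφs k).1.continuous (isWeilTest_weilConv_moll hφc hφs k).2 k

/-- RH-FREE.  `‖ψ_k‖_∞ ≤ ‖φ‖_∞`. -/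
theorem norm_moll2_le (hφc : Continuous φ) (hφs : HasCompactSupport φ) {M : ℝ} (hM : ∀ x, ‖φ x‖ ≤ M)
    (k : ℕ) (x : ℝ) : ‖weilConv (weilConv φ (moll k)) (moll k) x‖ ≤ M :=
  norm_weilConv_moll_le (isWeilTest_weilConv_moll hφc hφs k).1.continuous
    (norm_weilConv_moll_le hφc hM k) k x

/-- RH-FREE.  `ψ_k` has the Hölder modulus of `φ`. -/
theorem holder_moll2 (hφc : Continuous φ) (hφs : HasCompactSupport φ) {C α : ℝ}
    (hH : ∀ a y : ℝ, |y| ≤ 1 → ‖φ (a + y) - φ a‖ ≤ C * |y| ^ α) (k : ℕ) (a y : ℝ) (hy : |y| ≤ 1) :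
    ‖weilConv (weilConv φ (moll k)) (moll k) (a + y) - weilConv (weilConv φ (moll k)) (moll k) a‖ ≤
      C * |y| ^ α :=
  holder_weilConv_moll (isWeilTest_weilConv_moll hφc hφs k).1.continuous
    (fun a y hy ↦ holder_weilConv_moll hφc hH k a y hy) k a y hy

/-- RH-FREE.  `‖ψ_k(x) − φ(x)‖ ≤ 2C r_k^α` for every `x`. -/
theorem norm_moll2_sub_le (hφc : Continuous φ) (hφs : HasCompactSupport φ) {C α : ℝ} (hC : 0 ≤ C)
    (hα : 0 < α) (hH : ∀ a y : ℝ, |y| ≤ 1 → ‖φ (a + y) - φ a‖ ≤ C * |y| ^ α) (k : ℕ) (x : ℝ) :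
    ‖weilConv (weilConv φ (moll k)) (moll k) x - φ x‖ ≤ 2 * C * (bump k).rOut ^ α := by
  have h1 := norm_weilConv_moll_sub_self_le (isWeilTest_weilConv_moll hφc hφs k).1.continuous hC hα
    (fun a y hy ↦ holder_weilConv_moll hφc hH k a y hy) k x
  have h2 := norm_weilConv_moll_sub_self_le hφc hC hα hH k x
  calc ‖weilConv (weilConv φ (moll k)) (moll k) x - φ x‖
      ≤ ‖weilConv (weilConv φ (moll k)) (moll k) x - weilConv φ (moll k) x‖ +
          ‖weilConv φ (moll k) x - φ x‖ := norm_sub_le_norm_sub_add_norm_sub _ _ _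
    _ ≤ C * (bump k).rOut ^ α + C * (bump k).rOut ^ α := add_le_add h1 h2
    _ = 2 * C * (bump k).rOut ^ α := by ring

/-- RH-FREE.  `ψ_k → φ` pointwise (indeed uniformly). -/
theorem tendsto_moll2 (hφc : Continuous φ) (hφs : HasCompactSupport φ) {C α : ℝ} (hC : 0 ≤ C)
    (hα : 0 < α) (hH : ∀ a y : ℝ, |y| ≤ 1 → ‖φ (a + y) - φ a‖ ≤ C * |y| ^ α) (x : ℝ) :
    Tendsto (fun k ↦ weilConv (weilConv φ (moll k)) (moll k) x) atTop (𝓝 (φ x)) := by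
  have hr := (tendsto_bump_rOut.rpow_const (p := α) (Or.inr hα.le)).const_mul (2 * C)
  rw [Real.zero_rpow hα.ne', mul_zero] at hr
  rw [tendsto_iff_norm_sub_tendsto_zero]
  exact squeeze_zero (fun _ ↦ norm_nonneg _) (fun k ↦ norm_moll2_sub_le hφc hφs hC hα hH k x) hr

/-! ## §3 The series terms: a uniform summable majorant -/

/-- RH-FREE.  The weight `e^{−(2n+½)x}` as a real exponential. -/
theorem cexp_archWeight (n : ℕ) (x : ℝ) :
    cexp ((-(2 * (n : ℂ)) - 1 / 2) * x) = ((Real.exp (-(2 * n + 1 / 2) * x) : ℝ) : ℂ) := by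
  rw [Complex.ofReal_exp]
  congr 1
  push_cast
  ring

/-- RH-FREE.  `‖e^{−(2n+½)x}‖ = e^{−(2n+½)x}`. -/
theorem norm_cexp_archWeight (n : ℕ) (x : ℝ) :
    ‖cexp ((-(2 * (n : ℂ)) - 1 / 2) * x)‖ = Real.exp (-(2 * n + 1 / 2) * x) := by
  rw [cexp_archWeight, Complex.norm_real, Real.norm_eq_abs, abs_of_pos (Real.exp_pos _)]
/-- RH-FREE.  `∫₀^∞ e^{−(2n+½)x} dx = 1/(2n+½)`. -/
theorem integral_archWeight (n : ℕ) :
    ∫ x in Ioi (0 : ℝ), cexp ((-(2 * (n : ℂ)) - 1 / 2) * x) = (((1 / (2 * (n : ℝ) + 1 / 2) : ℝ)) : ℂ) := by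
  simp_rw [cexp_archWeight]
  rw [integral_complex_ofReal]
  congr 1
  have hr : (0 : ℝ) < 2 * n + 1 / 2 := by positivity
  have h := Real.integral_rpow_mul_exp_neg_mul_Ioi (a := 1) (r := 2 * (n : ℝ) + 1 / 2) one_pos hr
  rw [sub_self, Real.rpow_one, Real.Gamma_one, mul_one] at h
  rw [← h]
  refine setIntegral_congr_fun measurableSet_Ioi fun x _ ↦ ?_
  rw [Real.rpow_zero, one_mul, neg_mul]

/-- RH-FREE.  The Gamma majorant `x^α e^{−(2n+½)x}` is integrable on `(0,∞)` with integral
`Γ(α+1)(2n+½)^{−(α+1)}`. -/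
theorem integral_rpow_mul_archWeight {α : ℝ} (hα : 0 < α) (n : ℕ) :
    IntegrableOn (fun x : ℝ ↦ x ^ α * Real.exp (-(2 * n + 1 / 2) * x)) (Ioi 0) ∧
    ∫ x in Ioi (0 : ℝ), x ^ α * Real.exp (-(2 * n + 1 / 2) * x) =
      (1 / (2 * (n : ℝ) + 1 / 2)) ^ (α + 1) * Real.Gamma (α + 1) := by
  have hr : (0 : ℝ) < 2 * n + 1 / 2 := by positivity
  constructor
  · have h := integrableOn_rpow_mul_exp_neg_mul_rpow (s := α) (p := 1) (b := 2 * (n : ℝ) + 1 / 2)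
      (by linarith) le_rfl hr
    refine h.congr_fun (fun x _ ↦ ?_) measurableSet_Ioi
    simp only [Real.rpow_one]
  · have h := Real.integral_rpow_mul_exp_neg_mul_Ioi (a := α + 1) (r := 2 * (n : ℝ) + 1 / 2) (by linarith) hr
    simp only [add_sub_cancel_right] at h
    rw [← h]
    refine setIntegral_congr_fun measurableSet_Ioi fun x _ ↦ ?_
    congr 1
    ring

/-- RH-FREE.  **Two-sided Hölder bound at `0`, extended to all `x > 0`**: if `‖f‖_∞ ≤ M`, `M ≥ 0`, `C ≥ 0` and
`‖f(a+y) − f(a)‖ ≤ C|y|^α` for `|y| ≤ 1`, then `‖f(x) + f(−x) − 2f(0)‖ ≤ (2C + 4M) x^α` for every `x > 0`. -/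
theorem norm_symm_sub_le {f : ℝ → ℂ} {M C α : ℝ} (hM0 : 0 ≤ M) (hC : 0 ≤ C) (hα : 0 < α)
    (hM : ∀ x, ‖f x‖ ≤ M) (hH : ∀ a y : ℝ, |y| ≤ 1 → ‖f (a + y) - f a‖ ≤ C * |y| ^ α) {x : ℝ} (hx : 0 < x) :
    ‖f x + f (-x) - 2 * f 0‖ ≤ (2 * C + 4 * M) * x ^ α := by
  have hxα : 0 ≤ x ^ α := Real.rpow_nonneg hx.le α
  have hsplit : f x + f (-x) - 2 * f 0 = (f (0 + x) - f 0) + (f (0 + -x) - f 0) := by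
    rw [zero_add, zero_add]; ring
  rw [hsplit]
  refine (norm_add_le _ _).trans ?_
  rcases le_or_gt x 1 with hx1 | hx1
  · have h1 := hH 0 x (by rwa [abs_of_pos hx])
    have h2 := hH 0 (-x) (by rwa [abs_neg, abs_of_pos hx])
    rw [abs_of_pos hx] at h1
    rw [abs_neg, abs_of_pos hx] at h2
    nlinarith
  · have h1 : ‖f (0 + x) - f 0‖ ≤ 2 * M := (norm_sub_le _ _).trans (by linarith [hM (0 + x), hM 0])
    have h2 : ‖f (0 + -x) - f 0‖ ≤ 2 * M := (norm_sub_le _ _).trans (by linarith [hM (0 + -x), hM 0])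
    have h3 : 1 ≤ x ^ α := Real.one_le_rpow hx1.le hα.le
    nlinarith

/-- RH-FREE.  **Rewriting the series term**: for continuous bounded `f`,
`4π f(0)/(n+1) − 4π∫₀^∞ (f(x)+f(−x))e^{−(2n+½)x}dx
  = 4π f(0)(1/(n+1) − 1/(n+¼)) − 4π ∫₀^∞ (f(x)+f(−x)−2f(0)) e^{−(2n+½)x} dx`. -/
theorem archSeriesTerm_eq {f : ℝ → ℂ} (hf : Continuous f) {M : ℝ} (hM : ∀ x, ‖f x‖ ≤ M) (n : ℕ) :
    4 * π * f 0 / ((n : ℂ) + 1) - 4 * π * ∫ x in Ioi (0 : ℝ), (f x + f (-x)) * cexp ((-(2 * (n : ℂ)) - 1 / 2) * x) =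
      4 * π * f 0 * (1 / ((n : ℂ) + 1) - (((1 / ((n : ℝ) + 1 / 4) : ℝ)) : ℂ)) -
        4 * π * ∫ x in Ioi (0 : ℝ), (f x + f (-x) - 2 * f 0) * cexp ((-(2 * (n : ℂ)) - 1 / 2) * x) := by
  have hr : (0 : ℝ) < 2 * n + 1 / 2 := by positivity
  -- integrability of the weight and of the two integrands on `(0, ∞)`
  have hE : IntegrableOn (fun x : ℝ ↦ cexp ((-(2 * (n : ℂ)) - 1 / 2) * x)) (Ioi 0) :=
    Integrable.mono' (exp_neg_integrableOn_Ioi 0 hr)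
      (by fun_prop : Continuous fun x : ℝ ↦ cexp ((-(2 * (n : ℂ)) - 1 / 2) * x)).aestronglyMeasurable
      (Eventually.of_forall fun x ↦ (norm_cexp_archWeight n x).le)
  have hbd : ∀ g : ℝ → ℂ, Continuous g → (∀ x, ‖g x‖ ≤ 4 * M) →
      IntegrableOn (fun x : ℝ ↦ g x * cexp ((-(2 * (n : ℂ)) - 1 / 2) * x)) (Ioi 0) := by
    intro g hg hgM
    refine Integrable.mono' (hE.norm.const_mul (4 * M)) ?_ (Eventually.of_forall fun x ↦ ?_)
    · exact (hg.mul (by fun_prop)).aestronglyMeasurable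
    · rw [norm_mul]
      exact mul_le_mul_of_nonneg_right (hgM x) (norm_nonneg _)
  have hM0 : 0 ≤ M := (norm_nonneg _).trans (hM 0)
  have hI1 : IntegrableOn (fun x : ℝ ↦ (f x + f (-x) - 2 * f 0) * cexp ((-(2 * (n : ℂ)) - 1 / 2) * x)) (Ioi 0) :=
    hbd _ ((hf.add (hf.comp continuous_neg)).sub continuous_const) fun x ↦ by
      calc ‖f x + f (-x) - 2 * f 0‖ ≤ ‖f x‖ + ‖f (-x)‖ + ‖2 * f 0‖ := norm_sub_le_of_le (norm_add_le _ _) le_rfl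
        _ ≤ M + M + 2 * M := by
            rw [norm_mul, Complex.norm_two]
            linarith [hM x, hM (-x), hM 0]
        _ = 4 * M := by ring
  have hI2 : IntegrableOn (fun x : ℝ ↦ (2 * f 0) * cexp ((-(2 * (n : ℂ)) - 1 / 2) * x)) (Ioi 0) :=
    hE.const_mul _
  have hsum : (fun x : ℝ ↦ (f x + f (-x)) * cexp ((-(2 * (n : ℂ)) - 1 / 2) * x)) =
      fun x : ℝ ↦ (f x + f (-x) - 2 * f 0) * cexp ((-(2 * (n : ℂ)) - 1 / 2) * x) +
        (2 * f 0) * cexp ((-(2 * (n : ℂ)) - 1 / 2) * x) := by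
    funext x; ring
  rw [hsum, integral_add hI1 hI2, integral_const_mul, integral_archWeight]
  have h14 : (((1 / ((n : ℝ) + 1 / 4) : ℝ)) : ℂ) = 2 * (((1 / (2 * (n : ℝ) + 1 / 2) : ℝ)) : ℂ) := by
    have h1 : (n : ℝ) + 1 / 4 ≠ 0 := by positivity
    have h2 : 2 * (n : ℝ) + 1 / 2 ≠ 0 := by positivity
    rw [← Complex.ofReal_ofNat, ← Complex.ofReal_mul]
    congr 1
    field_simp
    ring
  rw [h14]
  ring

/-- RH-FREE.  **Uniform summable majorant of the series terms**: for continuous `f` with `‖f‖_∞ ≤ M`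
and Hölder data `(C, α)`,
`‖4π f(0)/(n+1) − 4π∫₀^∞ (f(x)+f(−x))e^{−(2n+½)x}dx‖ ≤ 4π(3M/(n+1)² + (2C+4M)Γ(α+1)(1/(2n+½))^{α+1})`. -/
theorem norm_archSeriesTerm_le {f : ℝ → ℂ} (hf : Continuous f) {M C α : ℝ} (hC : 0 ≤ C) (hα : 0 < α)
    (hM : ∀ x, ‖f x‖ ≤ M) (hH : ∀ a y : ℝ, |y| ≤ 1 → ‖f (a + y) - f a‖ ≤ C * |y| ^ α) (n : ℕ) :
    ‖4 * π * f 0 / ((n : ℂ) + 1) - 4 * π * ∫ x in Ioi (0 : ℝ), (f x + f (-x)) * cexp ((-(2 * (n : ℂ)) - 1 / 2) * x)‖ ≤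
      4 * π * (3 * M / ((n : ℝ) + 1) ^ 2 +
        (2 * C + 4 * M) * Real.Gamma (α + 1) * (1 / (2 * (n : ℝ) + 1 / 2)) ^ (α + 1)) := by
  have hM0 : 0 ≤ M := (norm_nonneg _).trans (hM 0)
  rw [archSeriesTerm_eq hf hM n]
  obtain ⟨hGi, hGv⟩ := integral_rpow_mul_archWeight hα n
  -- the rational part
  have hn0 : (0 : ℝ) < (n : ℝ) + 1 := by positivity
  have hq : ‖1 / ((n : ℂ) + 1) - (((1 / ((n : ℝ) + 1 / 4) : ℝ)) : ℂ)‖ ≤ 3 / ((n : ℝ) + 1) ^ 2 := by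
    have e : 1 / ((n : ℂ) + 1) - (((1 / ((n : ℝ) + 1 / 4) : ℝ)) : ℂ) =
        (((1 / ((n : ℝ) + 1) - 1 / ((n : ℝ) + 1 / 4) : ℝ)) : ℂ) := by push_cast; ring
    rw [e, Complex.norm_real, Real.norm_eq_abs]
    have h14 : (0 : ℝ) < (n : ℝ) + 1 / 4 := by positivity
    have hval : 1 / ((n : ℝ) + 1) - 1 / ((n : ℝ) + 1 / 4) = -(3 / 4) / (((n : ℝ) + 1) * ((n : ℝ) + 1 / 4)) := by
      field_simp; ring
    rw [hval, abs_div, abs_of_pos (mul_pos hn0 h14), show |(-(3 / 4) : ℝ)| = 3 / 4 by norm_num,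
      div_le_div_iff₀ (mul_pos hn0 h14) (pow_pos hn0 2)]
    nlinarith
  -- the integral part
  have hint : ‖∫ x in Ioi (0 : ℝ), (f x + f (-x) - 2 * f 0) * cexp ((-(2 * (n : ℂ)) - 1 / 2) * x)‖ ≤
      (2 * C + 4 * M) * Real.Gamma (α + 1) * (1 / (2 * (n : ℝ) + 1 / 2)) ^ (α + 1) := by
    have h1 : ‖∫ x in Ioi (0 : ℝ), (f x + f (-x) - 2 * f 0) * cexp ((-(2 * (n : ℂ)) - 1 / 2) * x)‖ ≤
        ∫ x in Ioi (0 : ℝ), (2 * C + 4 * M) * (x ^ α * Real.exp (-(2 * n + 1 / 2) * x)) := by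
      refine norm_integral_le_of_norm_le (hGi.const_mul _) ?_
      refine (ae_restrict_iff' measurableSet_Ioi).2 (Eventually.of_forall fun x hx ↦ ?_)
      rw [norm_mul, norm_cexp_archWeight]
      have h := norm_symm_sub_le hM0 hC hα hM hH (mem_Ioi.1 hx)
      have hE : 0 ≤ Real.exp (-(2 * n + 1 / 2) * x) := (Real.exp_pos _).le
      calc ‖f x + f (-x) - 2 * f 0‖ * Real.exp (-(2 * n + 1 / 2) * x)
          ≤ ((2 * C + 4 * M) * x ^ α) * Real.exp (-(2 * n + 1 / 2) * x) := mul_le_mul_of_nonneg_right h hE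
        _ = (2 * C + 4 * M) * (x ^ α * Real.exp (-(2 * n + 1 / 2) * x)) := by ring
    rw [integral_const_mul, hGv] at h1
    linarith
  calc ‖4 * π * f 0 * (1 / ((n : ℂ) + 1) - (((1 / ((n : ℝ) + 1 / 4) : ℝ)) : ℂ)) -
        4 * π * ∫ x in Ioi (0 : ℝ), (f x + f (-x) - 2 * f 0) * cexp ((-(2 * (n : ℂ)) - 1 / 2) * x)‖
      ≤ ‖4 * π * f 0 * (1 / ((n : ℂ) + 1) - (((1 / ((n : ℝ) + 1 / 4) : ℝ)) : ℂ))‖ +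
          ‖4 * π * ∫ x in Ioi (0 : ℝ), (f x + f (-x) - 2 * f 0) * cexp ((-(2 * (n : ℂ)) - 1 / 2) * x)‖ :=
        norm_sub_le _ _
    _ ≤ 4 * π * M * (3 / ((n : ℝ) + 1) ^ 2) +
          4 * π * ((2 * C + 4 * M) * Real.Gamma (α + 1) * (1 / (2 * (n : ℝ) + 1 / 2)) ^ (α + 1)) := by
        have hπ : ‖(4 : ℂ) * π‖ = 4 * π := by
          rw [norm_mul, Complex.norm_real, Real.norm_eq_abs, abs_of_pos Real.pi_pos]; norm_num
        have ha : ‖4 * π * f 0 * (1 / ((n : ℂ) + 1) - (((1 / ((n : ℝ) + 1 / 4) : ℝ)) : ℂ))‖ ≤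
            4 * π * M * (3 / ((n : ℝ) + 1) ^ 2) := by
          rw [norm_mul, norm_mul, hπ]
          exact mul_le_mul (mul_le_mul_of_nonneg_left (hM 0) (by positivity)) hq (norm_nonneg _)
            (by positivity)
        have hb : ‖4 * π * ∫ x in Ioi (0 : ℝ), (f x + f (-x) - 2 * f 0) * cexp ((-(2 * (n : ℂ)) - 1 / 2) * x)‖ ≤
            4 * π * ((2 * C + 4 * M) * Real.Gamma (α + 1) * (1 / (2 * (n : ℝ) + 1 / 2)) ^ (α + 1)) := by
          rw [norm_mul, hπ]
          exact mul_le_mul_of_nonneg_left hint (by positivity)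
        exact add_le_add ha hb
    _ = 4 * π * (3 * M / ((n : ℝ) + 1) ^ 2 +
          (2 * C + 4 * M) * Real.Gamma (α + 1) * (1 / (2 * (n : ℝ) + 1 / 2)) ^ (α + 1)) := by ring

/-- RH-FREE.  The majorant is summable. -/
theorem summable_archSeriesMajorant (M C α : ℝ) (hα : 0 < α) :
    Summable fun n : ℕ ↦ 4 * π * (3 * M / ((n : ℝ) + 1) ^ 2 +
      (2 * C + 4 * M) * Real.Gamma (α + 1) * (1 / (2 * (n : ℝ) + 1 / 2)) ^ (α + 1)) := by
  refine Summable.mul_left _ (Summable.add ?_ ?_)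
  · have h := (Real.summable_one_div_nat_pow.2 one_lt_two)
    have h' : Summable fun n : ℕ ↦ 1 / ((n : ℝ) + 1) ^ 2 := by exact_mod_cast (summable_nat_add_iff 1).2 h
    simpa [div_eq_mul_one_div (3 * M)] using h'.mul_left (3 * M)
  · refine Summable.mul_left _ ?_
    have h := (Real.summable_nat_rpow_inv.2 (by linarith : 1 < α + 1))
    have h' : Summable fun n : ℕ ↦ (((n : ℝ) + 1) ^ (α + 1))⁻¹ := by exact_mod_cast (summable_nat_add_iff 1).2 h
    refine (h'.mul_left ((2 : ℝ) ^ (α + 1))).of_nonneg_of_le (fun n ↦ by positivity) fun n ↦ ?_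
    have hn : (0 : ℝ) ≤ n := n.cast_nonneg
    have hle : 1 / (2 * (n : ℝ) + 1 / 2) ≤ 2 / ((n : ℝ) + 1) := by
      rw [div_le_div_iff₀ (by positivity) (by positivity)]; linarith
    calc (1 / (2 * (n : ℝ) + 1 / 2)) ^ (α + 1) ≤ (2 / ((n : ℝ) + 1)) ^ (α + 1) :=
          Real.rpow_le_rpow (by positivity) hle (by linarith)
      _ = (2 : ℝ) ^ (α + 1) * (((n : ℝ) + 1) ^ (α + 1))⁻¹ := by
          rw [Real.div_rpow (by norm_num) (by positivity), div_eq_mul_inv]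

/-! ## §4 Tannery: the series along the double mollification -/

/-- RH-FREE.  **Termwise convergence**: for each `n`, the series term of `ψ_k` tends to that of `φ`
(dominated convergence on `(0,∞)`, majorant `2‖φ‖_∞ e^{−(2n+½)x}`). -/
theorem tendsto_archSeriesTerm_moll2 (hφc : Continuous φ) (hφs : HasCompactSupport φ) {C α : ℝ} (hC : 0 ≤ C)
    (hα : 0 < α) (hH : ∀ a y : ℝ, |y| ≤ 1 → ‖φ (a + y) - φ a‖ ≤ C * |y| ^ α) (n : ℕ) :
    Tendsto (fun k ↦ 4 * π * weilConv (weilConv φ (moll k)) (moll k) 0 / ((n : ℂ) + 1) -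
        4 * π * ∫ x in Ioi (0 : ℝ), (weilConv (weilConv φ (moll k)) (moll k) x +
          weilConv (weilConv φ (moll k)) (moll k) (-x)) * cexp ((-(2 * (n : ℂ)) - 1 / 2) * x)) atTop
      (𝓝 (4 * π * φ 0 / ((n : ℂ) + 1) -
        4 * π * ∫ x in Ioi (0 : ℝ), (φ x + φ (-x)) * cexp ((-(2 * (n : ℂ)) - 1 / 2) * x))) := by
  obtain ⟨M, hM⟩ : ∃ M, ∀ x, ‖φ x‖ ≤ M := by
    obtain ⟨M, hM⟩ := (hφs.isCompact_range hφc).isBounded.exists_norm_le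
    exact ⟨M, fun x ↦ hM _ (mem_range_self x)⟩
  have hr : (0 : ℝ) < 2 * n + 1 / 2 := by positivity
  refine ((((tendsto_moll2 hφc hφs hC hα hH 0).const_mul _).div_const _)).sub
    (Tendsto.const_mul _ ?_)
  refine tendsto_integral_of_dominated_convergence (fun x ↦ 2 * M * Real.exp (-(2 * n + 1 / 2) * x))
    (fun k ↦ ?_) ?_ (fun k ↦ ?_) ?_
  · have hc := (isWeilTest_moll2 hφc hφs k).1.continuous
    exact ((hc.add (hc.comp continuous_neg)).mul (by fun_prop)).aestronglyMeasurable
  · exact (exp_neg_integrableOn_Ioi 0 hr).const_mul _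
  · refine Eventually.of_forall fun x ↦ ?_
    rw [norm_mul, norm_cexp_archWeight]
    refine mul_le_mul_of_nonneg_right ((norm_add_le _ _).trans ?_) (Real.exp_pos _).le
    linarith [norm_moll2_le hφc hφs hM k x, norm_moll2_le hφc hφs hM k (-x)]
  · refine Eventually.of_forall fun x ↦ ?_
    exact ((tendsto_moll2 hφc hφs hC hα hH x).add (tendsto_moll2 hφc hφs hC hα hH (-x))).mul_const _

/-- **RH-FREE · the archimedean series along the double mollification**: for continuous, compactly
supported, Hölder `φ`, the series of `φ` is summable and
`2·weilArchIntegral ψ_k + 4πγ ψ_k(0) ⟶ Σₙ (4π φ(0)/(n+1) − 4π ∫₀^∞ (φ(x)+φ(−x)) e^{−(2n+½)x} dx)` as `k → ∞`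
(the left side is the series of the test function `ψ_k` by the tree's `hasSum_weilArchIntegral`; Tannery).
Nothing here bears on RH. -/
theorem tendsto_archSeries_moll2 (hφc : Continuous φ) (hφs : HasCompactSupport φ) {C α : ℝ} (hC : 0 ≤ C)
    (hα : 0 < α) (hH : ∀ a y : ℝ, |y| ≤ 1 → ‖φ (a + y) - φ a‖ ≤ C * |y| ^ α) :
    Summable (fun n : ℕ ↦ 4 * π * φ 0 / ((n : ℂ) + 1) -
        4 * π * ∫ x in Ioi (0 : ℝ), (φ x + φ (-x)) * cexp ((-(2 * (n : ℂ)) - 1 / 2) * x)) ∧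
    Tendsto (fun k ↦ 2 * weilArchIntegral (weilConv (weilConv φ (moll k)) (moll k)) +
        4 * π * Real.eulerMascheroniConstant * weilConv (weilConv φ (moll k)) (moll k) 0) atTop
      (𝓝 (∑' n : ℕ, (4 * π * φ 0 / ((n : ℂ) + 1) -
        4 * π * ∫ x in Ioi (0 : ℝ), (φ x + φ (-x)) * cexp ((-(2 * (n : ℂ)) - 1 / 2) * x)))) := by
  obtain ⟨M, hM⟩ : ∃ M, ∀ x, ‖φ x‖ ≤ M := by
    obtain ⟨M, hM⟩ := (hφs.isCompact_range hφc).isBounded.exists_norm_le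
    exact ⟨M, fun x ↦ hM _ (mem_range_self x)⟩
  have hsum := summable_archSeriesMajorant M C α hα
  constructor
  · exact hsum.of_norm_bounded fun n ↦ norm_archSeriesTerm_le hφc hC hα hM hH n
  · have hT := tendsto_tsum_of_dominated_convergence hsum (fun n ↦ tendsto_archSeriesTerm_moll2 hφc hφs hC hα hH n)
      (Eventually.of_forall fun k n ↦ norm_archSeriesTerm_le (isWeilTest_moll2 hφc hφs k).1.continuous hC hα
        (norm_moll2_le hφc hφs hM k) (holder_moll2 hφc hφs hH k) n)
    refine hT.congr fun k ↦ ?_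
    exact (hasSum_weilArchIntegral (isWeilTest_moll2 hφc hφs k)).tsum_eq

end Summit.RiemannHypothesis.RiemannHypothesis.Theorems.SuzukiFlowPairing

end
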